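import Summits.CriticalPhenomena.PercolationContinuityZ3.Theorems.PercNearOneGluingNoHeavyLowerTailQ7PsiZFree
import HarnessLib

/-!
# `NoHeavyLowerTail` (stmt-CriticalPhenomena-4575) — (GΨ₃) with two strong relays and a constant threshold
# (the `z`-free dual certificate, end to end)

Support file (`--supports stmt-CriticalPhenomena-4575`), coupling seat `prim-cplus-coupling` (gen 7).  No
definitions, no named facts, no sorries.

Context (seat memos A5-COUPLING-gen5.md §3–§4, A5-COUPLING-gen7.md §0.4).  The conjecture (GΨ₃) says: for a
finite weighted graph, a monotone real cluster property `F` and vertices `o, x, y, z` with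
`E F(C(x)) ≥ E F(C(z))` and `E F(C(y)) ≥ E F(C(z))`, one has `E[(F(C(o)) − F(C(z))); o ↔ {x,y}] ≥ 0`
(it implies Kozma–Nitzan's Question 7 at `|A| = 3` for every observer, tree `Q7Psi.q7_of_psi`).  The case
`k = 2` is `Q7Psi.gpsi_two`; the star class is `Q7Psi.gpsi_three_star` / `gpsi_star`.  This file proves
the case in which the weak relay's value `F(C(z))` is replaced by a CONSTANT `c₀` (e.g. `z` isolated), for
EVERY observer `o` — by the `z`-free dual certificate of the seat (observer exchange `Q7Psi.obs_exchange`
on both sides with the split `t = a'/(a'+b')`, then Harris):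

* `Q7Psi.gpsi_three_zfree` — `0 ≤ ∫ F(C(x))`, `0 ≤ ∫ F(C(y))` imply `0 ≤ ∫_{x↔o ∪ y↔o} F(C(o))`;
* `Q7Psi.gpsi_three_const` — `c₀ ≤ ∫ F(C(x))`, `c₀ ≤ ∫ F(C(y))` imply `c₀ · μ(x↔o ∪ y↔o) ≤ ∫_{x↔o ∪ y↔o} F(C(o))`.
[cite: KozmaNitzan2024, §5.1 (pp. 31–32), Question 7 (p. 36)] [cite: VandenbergHaggstromKahn2005, Thms 1.3–1.4 (pp. 6–7)]
-/

namespace Summit.CriticalPhenomena.PercolationContinuityZ3.Theorems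

open MeasureTheory Set Literature.Probability.LatticeModels Literature.Probability.Percolation
open scoped Classical
open KNPreFKG

noncomputable section

namespace Q7Psi

variable {V : Type*} [Fintype V]

/-- **(GΨ₃) with two strong relays and a constant threshold — the `z`-free certificate end to end.**
If `0 ≤ ∫ F(C(x))` and `0 ≤ ∫ F(C(y))` for a monotone real cluster property `F`, then
`0 ≤ ∫_{x↔o ∪ y↔o} F(C(o))`.  (Shift `F` by a constant `c₀` to read it as: `E F(C(x)), E F(C(y)) ≥ c₀`
imply `E[F(C(o)); o ↔ {x,y}] ≥ c₀ · P(o ↔ {x,y})`; this is (GΨ₃) of the seat memo when `F(C(z))` is a.s.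
constant, e.g. `z` isolated.)  Proof: `obs_exchange` for `(x,y)` and for `(y,x)` with the split
`t = a'/(a'+b')`, `a' = μ(x↮y, x↔o)`, `b' = μ(x↮y, y↔o)`, then Harris (`harris_obs_union`) for `C(x)` and `C(y)`.
[cite: KozmaNitzan2024, §5.1 (pp. 31–32), Question 7 (p. 36)] [cite: VandenbergHaggstromKahn2005, Thms 1.3–1.4 (pp. 6–7)] -/
theorem gpsi_three_zfree (w : Sym2 V → unitInterval) (o x y : V) (hxy : x ≠ y) (F : Set V → ℝ)
    (hF : ∀ S T : Set V, S ⊆ T → F S ≤ F T)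
    (hx : 0 ≤ ∫ ω, F (openCluster ω x) ∂(prodBernoulli w))
    (hy : 0 ≤ ∫ ω, F (openCluster ω y) ∂(prodBernoulli w)) :
    0 ≤ ∫ ω in openConn x o ∪ openConn y o, F (openCluster ω o) ∂(prodBernoulli w) := by
  classical
  set μ := prodBernoulli w with hμ
  set D : Set (BondConfig V) := {ω | ¬ (openGraph ω).Reachable x y} with hD
  set Ox : Set (BondConfig V) := openConn x o with hOx
  set Oy : Set (BondConfig V) := openConn y o with hOy
  set J : Set (BondConfig V) := Ox ∪ Oy with hJ
  set fx : BondConfig V → ℝ := fun ω => F (openCluster ω x) with hfx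
  set fy : BondConfig V → ℝ := fun ω => F (openCluster ω y) with hfy
  set fo : BondConfig V → ℝ := fun ω => F (openCluster ω o) with hfo
  have hmeas : ∀ S : Set (BondConfig V), MeasurableSet S := fun _ => MeasurableSet.of_discrete
  have hint : ∀ (g : BondConfig V → ℝ) (S : Set (BondConfig V)), IntegrableOn g S μ :=
    fun g S => (Integrable.of_finite).integrableOn
  -- the exchange inequalities
  have ex1 := obs_exchange w o x y hxy F hF
  change μ.real (D ∩ Ox) * ∫ ω in D ∩ Oy, fx ω ∂μ ≤ μ.real (D ∩ Oy) * ∫ ω in D ∩ Ox, fx ω ∂μ at ex1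
  have hD' : {ω : BondConfig V | ¬ (openGraph ω).Reachable y x} = D := by
    ext ω
    simp only [hD, mem_setOf_eq]
    exact not_congr ⟨SimpleGraph.Reachable.symm, SimpleGraph.Reachable.symm⟩
  have ex2 := obs_exchange w o y x (Ne.symm hxy) F hF
  rw [hD'] at ex2
  change μ.real (D ∩ Oy) * ∫ ω in D ∩ Ox, fy ω ∂μ ≤ μ.real (D ∩ Ox) * ∫ ω in D ∩ Oy, fy ω ∂μ at ex2
  -- Harris for `C(x)` and `C(y)`
  have H1 := harris_obs_union w o x y F hF
  change μ.real J * ∫ ω, fx ω ∂μ ≤ ∫ ω in J, fx ω ∂μ at H1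
  have H2 := harris_obs_union w o y x F hF
  rw [show openConn y o ∪ openConn x o = J from union_comm _ _] at H2
  change μ.real J * ∫ ω, fy ω ∂μ ≤ ∫ ω in J, fy ω ∂μ at H2
  -- three-way split of `∫_J`
  have hJD : J ∩ D = (D ∩ Ox) ∪ (D ∩ Oy) := by
    ext ω
    simp only [hJ, mem_inter_iff, mem_union]
    tauto
  have hdisj : Disjoint (D ∩ Ox) (D ∩ Oy) := by
    rw [Set.disjoint_left]
    rintro ω ⟨hDω, hxo⟩ ⟨_, hyo⟩
    exact hDω (SimpleGraph.Reachable.trans hxo (SimpleGraph.Reachable.symm hyo))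
  have hsplit : ∀ g : BondConfig V → ℝ, ∫ ω in J, g ω ∂μ =
      ∫ ω in D ∩ Ox, g ω ∂μ + ∫ ω in D ∩ Oy, g ω ∂μ + ∫ ω in J \ D, g ω ∂μ := by
    intro g
    rw [← integral_inter_add_sdiff (hmeas D) (hint g J), hJD,
      setIntegral_union hdisj (hmeas _) (hint g _) (hint g _)]
  -- cluster identifications
  have eOx : ∫ ω in D ∩ Ox, fo ω ∂μ = ∫ ω in D ∩ Ox, fx ω ∂μ := by
    refine setIntegral_congr_fun (hmeas _) fun ω hω => ?_
    simp only [hfo, hfx]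
    rw [openCluster_eq_of_reachable (show (openGraph ω).Reachable x o from hω.2)]
  have eOy : ∫ ω in D ∩ Oy, fo ω ∂μ = ∫ ω in D ∩ Oy, fy ω ∂μ := by
    refine setIntegral_congr_fun (hmeas _) fun ω hω => ?_
    simp only [hfo, hfy]
    rw [openCluster_eq_of_reachable (show (openGraph ω).Reachable y o from hω.2)]
  have eKo : ∫ ω in J \ D, fo ω ∂μ = ∫ ω in J \ D, fx ω ∂μ := by
    refine setIntegral_congr_fun ((hmeas J).diff (hmeas D)) fun ω hω => ?_
    simp only [hfo, hfx]
    have hxy' : (openGraph ω).Reachable x y := by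
      by_contra hc
      exact hω.2 hc
    have hxo : (openGraph ω).Reachable x o := by
      rcases hω.1 with h | h
      · exact h
      · exact hxy'.trans h
    rw [openCluster_eq_of_reachable hxo]
  have eKy : ∫ ω in J \ D, fy ω ∂μ = ∫ ω in J \ D, fx ω ∂μ := by
    refine setIntegral_congr_fun ((hmeas J).diff (hmeas D)) fun ω hω => ?_
    simp only [hfy, hfx]
    have hxy' : (openGraph ω).Reachable x y := by
      by_contra hc
      exact hω.2 hc
    rw [openCluster_eq_of_reachable hxy']
  -- bookkeeping
  set a' := μ.real (D ∩ Ox) with ha'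
  set b' := μ.real (D ∩ Oy) with hb'
  set Ix := ∫ ω in D ∩ Ox, fx ω ∂μ
  set Ixy := ∫ ω in D ∩ Oy, fx ω ∂μ
  set Iy := ∫ ω in D ∩ Oy, fy ω ∂μ
  set Iyx := ∫ ω in D ∩ Ox, fy ω ∂μ
  set K := ∫ ω in J \ D, fx ω ∂μ
  have hA : 0 ≤ K + Ix + Ixy := by
    have hJnn : 0 ≤ μ.real J := measureReal_nonneg
    have := hsplit fx
    nlinarith [mul_nonneg hJnn hx]
  have hB : 0 ≤ K + Iyx + Iy := by
    have hJnn : 0 ≤ μ.real J := measureReal_nonneg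
    have := hsplit fy
    rw [eKy] at this
    nlinarith [mul_nonneg hJnn hy]
  have hgoal : ∫ ω in J, fo ω ∂μ = Ix + Iy + K := by
    rw [hsplit fo, eOx, eOy, eKo]
  rw [hgoal]
  have ha0 : 0 ≤ a' := measureReal_nonneg
  have hb0 : 0 ≤ b' := measureReal_nonneg
  by_cases hab : a' + b' = 0
  · have ha : a' = 0 := by linarith
    have hb : b' = 0 := by linarith
    have hμx : μ (D ∩ Ox) = 0 := (measureReal_eq_zero_iff (measure_ne_top _ _)).1 ha
    have hμy : μ (D ∩ Oy) = 0 := (measureReal_eq_zero_iff (measure_ne_top _ _)).1 hb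
    have hIx : Ix = 0 := setIntegral_measure_zero _ hμx
    have hIy : Iy = 0 := setIntegral_measure_zero _ hμy
    have hIxy : Ixy = 0 := setIntegral_measure_zero _ hμy
    rw [hIx, hIy]
    rw [hIx, hIxy] at hA
    linarith
  · have hpos : 0 < a' + b' := lt_of_le_of_ne (by linarith) (Ne.symm hab)
    have key : 0 ≤ (a' + b') * (Ix + Iy + K) := by
      nlinarith [mul_nonneg ha0 hA, mul_nonneg hb0 hB, ex1, ex2]
    have key' : (a' + b') * 0 ≤ (a' + b') * (Ix + Iy + K) := by rwa [mul_zero]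
    exact le_of_mul_le_mul_left key' hpos

/-- **(GΨ₃) with a constant threshold, shifted form**: if `c₀ ≤ ∫ F(C(x))` and `c₀ ≤ ∫ F(C(y))` for a
monotone real cluster property `F` (under the probability measure `prodBernoulli w`), then
`c₀ · μ(x↔o ∪ y↔o) ≤ ∫_{x↔o ∪ y↔o} F(C(o))`: an observer connected to one of two relays whose clusters are
worth at least `c₀` on average has a cluster worth at least `c₀` on average — for one relay this is Harris,
for two it is `gpsi_three_zfree` applied to `F − c₀`.
[cite: KozmaNitzan2024, §5.1 (pp. 31–32), Question 7 (p. 36)] -/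
theorem gpsi_three_const (w : Sym2 V → unitInterval) (o x y : V) (hxy : x ≠ y) (F : Set V → ℝ)
    (hF : ∀ S T : Set V, S ⊆ T → F S ≤ F T) (c₀ : ℝ)
    (hx : c₀ ≤ ∫ ω, F (openCluster ω x) ∂(prodBernoulli w))
    (hy : c₀ ≤ ∫ ω, F (openCluster ω y) ∂(prodBernoulli w)) :
    c₀ * (prodBernoulli w).real (openConn x o ∪ openConn y o) ≤
      ∫ ω in openConn x o ∪ openConn y o, F (openCluster ω o) ∂(prodBernoulli w) := by
  classical
  set μ := prodBernoulli w with hμ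
  have hG : ∀ S T : Set V, S ⊆ T → F S - c₀ ≤ F T - c₀ := fun S T h => sub_le_sub_right (hF S T h) _
  have hGx : 0 ≤ ∫ ω, (F (openCluster ω x) - c₀) ∂μ := by
    rw [integral_sub Integrable.of_finite Integrable.of_finite, integral_const, probReal_univ, one_smul]
    linarith
  have hGy : 0 ≤ ∫ ω, (F (openCluster ω y) - c₀) ∂μ := by
    rw [integral_sub Integrable.of_finite Integrable.of_finite, integral_const, probReal_univ, one_smul]
    linarith
  have key := gpsi_three_zfree w o x y hxy (fun S => F S - c₀) hG hGx hGy
  have hJm : MeasurableSet (openConn x o ∪ openConn y o : Set (BondConfig V)) := MeasurableSet.of_discrete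
  rw [integral_sub (Integrable.of_finite).integrableOn (Integrable.of_finite).integrableOn,
    setIntegral_const, smul_eq_mul] at key
  change 0 ≤ (∫ ω in openConn x o ∪ openConn y o, F (openCluster ω o) ∂μ) -
    μ.real (openConn x o ∪ openConn y o) * c₀ at key
  linarith

end Q7Psi

end

end Summit.CriticalPhenomena.PercolationContinuityZ3.Theorems
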